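import Summits.AnomalousDissipation.AnomalousDissipation.Theorems.SolenoidalFractalHomogenisationLagrangianStepCellCorrectorContent
import HarnessLib

/-!
# K1L_D `LagrangianRenormalisationStepDesign` (stmt-AnomalousDissipation-27980), stub `stub_cellEnergyT` (clause (F) uniform in `T`, finding F-p4g10-1):
# the FAST CONTENT of a weak cell solution from a single-pair datum along a GENERAL grid-invariant bounded carrier — the S-item `CarrierFastContent`
# of p4 g10's typed split (helper; `--supports … --as helper`)

Summits-side helper file of route `SolenoidalFractalHomogenisation` (everything proved; no definitions, no named facts, no sorry).  `CarrierFastContent` of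
`Cruxes/LagrangianRenormalisationStep/DualLeakageSketch.lean` §3 (planner ad-ideate-p4 g10, v3 sha16 9fb1fcf710fcd042; cell STATUS 2026-08-28T13:43:50Z /
13:49:46Z «FREE») is `cell_corrector_content`'s fast-block computation (p634914, `lead-k1l-onelevel-p1` g0, §3–§4) for a GENERAL carrier with the three
properties its proof uses (`L^∞` space–time lift, sup bound `k/(2πn)`, invariance under the `n`-torsion grid), a GENERAL constant tensor `𝔹` in an elliptic
window `NearIso 𝔹 lo' hi'`, `0 < lo'`, and a GENERAL `L²` weakly divergence-free datum `φ` supported on the Fourier modes `{±ℓ}` (`ℓ ≠ 0`, `2|ℓᵢ| ≤ n`):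
for every weak solution `ψ` and a.e. `r ∈ (0,T')`,

  `∫‖ψ r‖² − (‖𝓕ψ(r)(ℓ)‖² + ‖𝓕ψ(r)(−ℓ)‖²) ≤ (3·(k/(2πn))·(2π‖ℓ‖))²·∫‖φ‖² / (4π²·lo'·(n²/4))²`

(`ae_complement_pair_energy_le`, EXACTLY the Prop's body, so `carrierFastContent : CarrierFastContent := ae_complement_pair_energy_le` wherever the Prop is
landed).  Proof = the lead's text with the carrier facts turned into hypotheses: Bloch-sector preservation along the grid-invariant carrier
(`PassiveVectorTensorSymmetry.ae_mFourierCoeff_eq_zero_off_sector`) puts every non-`{±ℓ}` active mode at `|k'|² ≥ n²/4` (`freqNormSq_ge_of_sector`), the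
energy inequality bounds the slow-block dissipation by `Γ² = 4π²‖ℓ‖²∫‖φ‖²`, and the fast-block bound `PassiveVectorTensorFastBlock.ae_complement_energy_le`
(`S = {±ℓ}`, `ρ = n²/4`, `M = k/(2πn)`) gives the estimate.  Used by the typed split with `𝔹 = majorTranspose ((1/n²)•𝔸)`, `lo' = νlo/(λn²)`, carrier
`revCarrier (cellField …) t₀`.  Infrastructure for route-1's rung leaf F-D1.A0 (a frontier FORMAL rung); NOT a proof of the stub, of the crux, of
Onsager's conjecture or of anomalous dissipation.  Prover seat `ad-k3l-bookkeeping-p1` g3 (idle-prover S-item), 2026-08-28.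
-/

set_option linter.dupNamespace false

noncomputable section

namespace Summit.AnomalousDissipation.AnomalousDissipation.Theorems.SolenoidalFractalHomogenisation.LagrangianStep

open Literature.Analysis Literature.Analysis.FluidPDE Literature.Analysis.FunctionSpaces
open Literature.Analysis.FluidPDE.LatticeShear
open MeasureTheory Set Filter Function UnitAddTorus
open scoped ENNReal NNReal InnerProductSpace

set_option maxHeartbeats 400000 in
/-- **Fast content of a weak cell solution from a single-pair datum along a grid-invariant bounded carrier** (the text of p4 g10's
`CarrierFastContent`): for a carrier with `L^∞` lift, sup `k/(2πn)` and `n`-grid invariance, a constant tensor `𝔹` with `NearIso 𝔹 lo' hi'`, `0 < lo'`,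
a mode `ℓ ≠ 0` with `2|ℓᵢ| ≤ n` and an `L²` weakly divergence-free datum supported on `{±ℓ}`, every weak solution keeps all but
`(3·(k/(2πn))·2π‖ℓ‖)²‖φ‖²/(4π²lo'·n²/4)²` of its energy on the two modes `±ℓ`, for a.e. time (sector preservation + fast-block bound).
[cite: RobinsonRodrigoSadowski2016, §4.2 (4.20)] [cite: KhaKuchment2021, §1.1–§1.2 (G-periodic operators, Floquet transform)] -/
theorem ae_complement_pair_energy_le :
    ∀ (k n : ℕ), 0 < n → ∀ (b' : ℝ → VF) (T' : ℝ),
      MemLp (FunctionSpaces.Torus.stLift b') ∞ (volume.restrict (Ioo 0 T' ×ˢ (univ : Set (EuclideanSpace ℝ (Fin 3))))) →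
      (∀ s x, ‖b' s x‖ ≤ (k:ℝ) / (2 * Real.pi * n)) →
      (∀ (j : Fin 3 → Fin n) (s : ℝ) (x : UnitAddTorus (Fin 3)),
          b' s (x + fun i => ((((j i : ℕ) : ℝ) / n : ℝ) : UnitAddCircle)) = b' s x) →
    ∀ (𝔹 : Torus.Visc4 (Fin 3)) (lo' hi' : ℝ), Torus.NearIso 𝔹 lo' hi' → 0 < lo' →
    ∀ ℓ : Fin 3 → ℤ, ℓ ≠ 0 → (∀ i, 2 * |(ℓ i : ℝ)| ≤ n) →
    ∀ φ : VF, MemLp φ 2 volume → FunctionSpaces.Torus.IsWeaklyDivFree φ →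
      (∀ k' : Fin 3 → ℤ, k' ≠ ℓ → k' ≠ -ℓ → mFourierCoeff (FunctionSpaces.EuclideanSpace.complexify ∘ φ) k' = 0) →
    ∀ ψ : ℝ → VF, Torus.IsWeakTensorPassiveVectorOn 0 T' 𝔹 b' φ ψ →
      ∀ᵐ r ∂(volume.restrict (Ioo 0 T')),
        (∫ x, ‖ψ r x‖ ^ 2) -
            (‖mFourierCoeff (FunctionSpaces.EuclideanSpace.complexify ∘ ψ r) ℓ‖ ^ 2 +
              ‖mFourierCoeff (FunctionSpaces.EuclideanSpace.complexify ∘ ψ r) (-ℓ)‖ ^ 2)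
          ≤ (3 * ((k:ℝ) / (2 * Real.pi * n)) * (2 * Real.pi * ‖Torus.latticeVec ℓ‖)) ^ 2 * (∫ x, ‖φ x‖ ^ 2) /
              (4 * Real.pi ^ 2 * lo' * ((n:ℝ) ^ 2 / 4)) ^ 2 := by
  intro k n hn b' T' hb hbsup hper 𝔹 lo' hi' hN hlo' ℓ hℓ hℓi φ hφ2 hdivφ hsuppφ ψ hψ
  classical
  have hnR : (0:ℝ) < n := by exact_mod_cast hn
  -- Fourier support of the datum: `{ℓ, −ℓ}`, inside the sector
  set S : Finset (Fin 3 → ℤ) := {ℓ, -ℓ} with hS_def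
  have hS : ∀ k' ∈ S, -k' ∈ S := by
    intro k' hk'
    rcases Finset.mem_insert.1 hk' with rfl | hk'
    · exact Finset.mem_insert_of_mem (Finset.mem_singleton_self _)
    · rw [Finset.mem_singleton.1 hk', neg_neg]; exact Finset.mem_insert_self _ _
  have hnotS : ∀ k', k' ∉ S → k' ≠ ℓ ∧ k' ≠ -ℓ := fun k' hk' =>
    ⟨fun h => hk' (h ▸ Finset.mem_insert_self _ _), fun h => hk' (h ▸ Finset.mem_insert_of_mem (Finset.mem_singleton_self _))⟩
  have hsupp₀ : ∀ k', k' ∉ S → mFourierCoeff (FunctionSpaces.EuclideanSpace.complexify ∘ φ) k' = 0 := fun k' hk' =>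
    hsuppφ k' (hnotS k' hk').1 (hnotS k' hk').2
  have hsuppSec : ∀ k', mFourierCoeff (FunctionSpaces.EuclideanSpace.complexify ∘ φ) k' ≠ 0 →
      (∀ i, (n : ℤ) ∣ k' i - ℓ i) ∨ (∀ i, (n : ℤ) ∣ k' i + ℓ i) := by
    intro k' hk'
    by_cases h1 : k' = ℓ
    · exact Or.inl fun i => by rw [h1, sub_self]; exact dvd_zero _
    by_cases h2 : k' = -ℓ
    · exact Or.inr fun i => by rw [h2, Pi.neg_apply, neg_add_cancel]; exact dvd_zero _
    exact absurd (hsuppφ k' h1 h2) hk'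
  -- sector preservation ⇒ spectral separation of the complement
  have hsec := hψ.ae_mFourierCoeff_eq_zero_off_sector hn ℓ hN hlo' hb hper hφ2 hsuppSec
  have hgap : ∀ᵐ s ∂(volume.restrict (Ioo 0 T')), ∀ k', k' ∉ S →
      mFourierCoeff (FunctionSpaces.EuclideanSpace.complexify ∘ ψ s) k' ≠ 0 → (n:ℝ) ^ 2 / 4 ≤ FunctionSpaces.Torus.freqNormSq k' := by
    filter_upwards [hsec] with s hs
    intro k' hk' hne
    have hin : (∀ i, (n : ℤ) ∣ k' i - ℓ i) ∨ (∀ i, (n : ℤ) ∣ k' i + ℓ i) := by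
      by_contra hc
      exact hne (hs k' hc)
    exact freqNormSq_ge_of_sector hℓi hin (hnotS k' hk').1 (hnotS k' hk').2
  -- the block dissipation bound `Γ² = 4π² ‖ℓ‖² E₀`
  obtain ⟨E₀, hE₀⟩ : ∃ E₀ : ℝ, E₀ = ∫ x, ‖φ x‖ ^ 2 := ⟨_, rfl⟩
  have hE₀nn : 0 ≤ E₀ := by rw [hE₀]; exact integral_nonneg fun x => sq_nonneg _
  rw [← hE₀]
  obtain ⟨Γ, hΓ⟩ : ∃ Γ : ℝ, Γ = 2 * Real.pi * ‖Torus.latticeVec ℓ‖ * Real.sqrt E₀ := ⟨_, rfl⟩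
  have hΓ0 : 0 ≤ Γ := by
    rw [hΓ]
    exact mul_nonneg (mul_nonneg (mul_nonneg (by norm_num) Real.pi_pos.le) (norm_nonneg _)) (Real.sqrt_nonneg _)
  have hΓsq : Γ ^ 2 = 4 * Real.pi ^ 2 * FunctionSpaces.Torus.freqNormSq ℓ * E₀ := by
    rw [hΓ, ← norm_latticeVec_sq', mul_pow, mul_pow, mul_pow, Real.sq_sqrt hE₀nn]; ring
  have hMb : 0 ≤ (k:ℝ) / (2 * Real.pi * n) := by positivity
  have hbM : ∀ᵐ s ∂(volume.restrict (Ioo 0 T')), ∀ᵐ x ∂volume, ‖b' s x‖ ≤ (k:ℝ) / (2 * Real.pi * n) :=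
    ae_of_all _ fun s => ae_of_all _ fun x => hbsup s x
  have hEle : ∀ᵐ s ∂(volume.restrict (Ioo 0 T')), ∫ x, ‖ψ s x‖ ^ 2 ≤ E₀ := by
    filter_upwards [hψ.ae_energy_ineq hN hlo' hφ2 hdivφ hb] with s hs
    have h1 : ENNReal.ofReal (∫ x, ‖ψ s x‖ ^ 2) ≤ ENNReal.ofReal E₀ := by rw [hE₀]; exact le_trans le_self_add hs
    exact (ENNReal.ofReal_le_ofReal_iff hE₀nn).1 h1
  have hslow : ∀ᵐ s ∂(volume.restrict (Ioo 0 T')), 4 * Real.pi ^ 2 * ∑ k' ∈ S, FunctionSpaces.Torus.freqNormSq k' *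
      ‖mFourierCoeff (FunctionSpaces.EuclideanSpace.complexify ∘ ψ s) k'‖ ^ 2 ≤ Γ ^ 2 := by
    filter_upwards [hEle, hψ.ae_memLp_two] with s hs hs2
    have hpars := Torus.integral_norm_sq_sub_realTrigPoly_coeff hS hs2
    have hsum : ∑ k' ∈ S, ‖mFourierCoeff (FunctionSpaces.EuclideanSpace.complexify ∘ ψ s) k'‖ ^ 2 ≤ E₀ := by
      have h0 : 0 ≤ ∫ x, ‖ψ s x - FunctionSpaces.Torus.realTrigPoly S
          (fun k' => mFourierCoeff (FunctionSpaces.EuclideanSpace.complexify ∘ ψ s) k') x‖ ^ 2 :=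
        integral_nonneg fun x => sq_nonneg _
      linarith
    have hfreq : ∀ k' ∈ S, FunctionSpaces.Torus.freqNormSq k' = FunctionSpaces.Torus.freqNormSq ℓ := by
      intro k' hk'
      rcases Finset.mem_insert.1 hk' with rfl | hk'
      · rfl
      · rw [Finset.mem_singleton.1 hk', FunctionSpaces.Torus.freqNormSq_neg]
    rw [Finset.sum_congr rfl fun k' hk' => by rw [hfreq k' hk'], ← Finset.mul_sum, hΓsq]
    have := FunctionSpaces.Torus.freqNormSq_nonneg ℓ
    have h2 := mul_le_mul_of_nonneg_left (mul_le_mul_of_nonneg_left hsum this) (by positivity : (0:ℝ) ≤ 4 * Real.pi ^ 2)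
    linarith
  -- the fast-block bound
  have hmain := hψ.ae_complement_energy_le hN hlo' hφ2 hdivφ hb hMb hbM S hS hsupp₀ (by positivity : (0:ℝ) < (n:ℝ) ^ 2 / 4)
    hgap hΓ0 hslow
  have hne : ℓ ≠ -ℓ := by
    intro h; apply hℓ; funext i
    have hi := congrArg (fun v => v i) h
    simp only [Pi.neg_apply] at hi
    have : ℓ i = 0 := by omega
    simpa using this
  filter_upwards [hmain] with t ht
  rw [hS_def, Finset.sum_pair hne] at ht
  refine ht.trans (le_of_eq ?_)
  rw [Fintype.card_fin]
  push_cast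
  have e : ((3:ℝ) * ((k:ℝ) / (2 * Real.pi * n)) * Γ) ^ 2 =
      (3 * ((k:ℝ) / (2 * Real.pi * n)) * (2 * Real.pi * ‖Torus.latticeVec ℓ‖)) ^ 2 * E₀ := by
    rw [hΓ, mul_pow, mul_pow, mul_pow, mul_pow, mul_pow, Real.sq_sqrt hE₀nn]; ring
  rw [e]

end Summit.AnomalousDissipation.AnomalousDissipation.Theorems.SolenoidalFractalHomogenisation.LagrangianStep

end
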